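import Literature.Computability.AlgebraicComplexity.LaserMethodTypes
import HarnessLib

/-!
# The laser method, combinatorial layer: free diagonals with the fibre bound `f ≤ |J_ν|`

Topic `Literature/Computability/AlgebraicComplexity`; a sharpening of
`exists_free_diagonal_typedSupport` (`LaserMethodTypes.lean`, Bürgisser–Clausen–Shokrollahi 1997,
proof of Thm. 15.41, step (B)).  There the size of the free diagonal `Δ` in the typed support
`Φ = (I_μ × J_ν × L_π) ∩ S^N` of a `b`-tight support `S` is bounded through the largest fibre `f`
of the three projections of `Φ`, of which only `1 ≤ f ≤ |Φ|` is recorded.  For a tight support a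
fibre of `Φ → I_μ` embeds into `J_ν` (the third word is determined by the first two), so in fact
`f ≤ max {|I_μ|, |J_ν|, |L_π|}` — the bound "`|V|/|W| ≤ |W|`, hence `p < 8|V|/|W| ≤ 8|W|`" of
Kleinberg–Sawin–Speyer 2018, §4 (proof of Thm. 13, p. 9), which is what keeps the Salem–Spencer
modulus `M = Θ(max(f, b))` of logarithmic size `log M ≤ log |W| + O(1)` (needed whenever the
Behrend loss `e^{−O(√log M)}` has to be controlled precisely, as in KSS Thm. 2).

* `card_fibre₁_le_card_typeClass₂` (and `₂₃`, `₃₁`) — fibres embed into type classes;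
* `exists_free_diagonal_typedSupport_fibre` — `exists_free_diagonal_typedSupport` with the extra
  conclusion `f ≤ max (|I_μ|, |J_ν|, |L_π|)`.

All proved; no definitions.

## References

* P. Bürgisser, M. Clausen, M. A. Shokrollahi, *Algebraic Complexity Theory* (1997), proof of
  Thm. 15.41, p. 381 (step (B)). [BurgisserClausenShokrollahi1997]
* R. Kleinberg, W. Sawin, D. Speyer, Discrete Analysis 2018:12, §4, Lemma 12 and proof of Thm. 13
  (p. 9 of the held text: "`p < 8|V|/|W| ≤ 8|W|`"). [KleinbergSawinSpeyer2018]
-/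

noncomputable section

open scoped BigOperators
open Finset

namespace Literature.Computability.AlgebraicComplexity

variable {I J L : Type*} [Fintype I] [Fintype J] [Fintype L] [DecidableEq I] [DecidableEq J]
  [DecidableEq L]

/-- In the typed support of a support `S` on which the third letter is determined by the first
two (`γ` injective, `α i + β j + γ l = 0` on `S`), every fibre of the first projection embeds into
the type class `J_ν` via the second word. [cite: KleinbergSawinSpeyer2018, §4 (proof of Thm. 13)] -/
theorem card_fibre₁_le_card_typeClass₂ (S : Finset (I × J × L)) {r : ℕ}
    (α : I → Fin r → ℤ) (β : J → Fin r → ℤ) (γ : L → Fin r → ℤ) (hγ : Function.Injective γ)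
    (htight : ∀ s ∈ S, ∀ ρ, α s.1 ρ + β s.2.1 ρ + γ s.2.2 ρ = 0)
    (N : ℕ) (μ : I → ℕ) (ν : J → ℕ) (π : L → ℕ) (x : Fin N → I) :
    ((typedSupport S N μ ν π).filter fun φ => φ.1 = x).card ≤ (typeClass N ν).card := by
  refine Finset.card_le_card_of_injOn (fun φ => φ.2.1) (fun φ hφ => ?_) ?_
  · rw [Finset.mem_coe, Finset.mem_filter] at hφ
    rw [Finset.mem_coe, mem_typeClass]
    exact (mem_typedSupport.1 hφ.1).2.1
  · intro φ hφ φ' hφ' h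
    rw [Finset.mem_coe, Finset.mem_filter] at hφ hφ'
    have hz : φ.2.2 = φ'.2.2 := by
      funext ρ
      apply hγ
      funext k
      have h1 := htight _ ((mem_typedSupport.1 hφ.1).2.2.2 ρ) k
      have h2 := htight _ ((mem_typedSupport.1 hφ'.1).2.2.2 ρ) k
      simp only at h1 h2
      have hx : φ.1 ρ = φ'.1 ρ := by rw [hφ.2, hφ'.2]
      have hy : φ.2.1 ρ = φ'.2.1 ρ := by simp only at h; rw [h]
      rw [hx, hy] at h1
      linarith
    simp only at h
    exact Prod.ext (hφ.2.trans hφ'.2.symm) (Prod.ext h hz)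

/-- Fibres of the second projection embed into `L_π` via the third word (`α` injective).
[cite: KleinbergSawinSpeyer2018, §4 (proof of Thm. 13)] -/
theorem card_fibre₂_le_card_typeClass₃ (S : Finset (I × J × L)) {r : ℕ}
    (α : I → Fin r → ℤ) (β : J → Fin r → ℤ) (γ : L → Fin r → ℤ) (hα : Function.Injective α)
    (htight : ∀ s ∈ S, ∀ ρ, α s.1 ρ + β s.2.1 ρ + γ s.2.2 ρ = 0)
    (N : ℕ) (μ : I → ℕ) (ν : J → ℕ) (π : L → ℕ) (y : Fin N → J) :
    ((typedSupport S N μ ν π).filter fun φ => φ.2.1 = y).card ≤ (typeClass N π).card := by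
  refine Finset.card_le_card_of_injOn (fun φ => φ.2.2) (fun φ hφ => ?_) ?_
  · rw [Finset.mem_coe, Finset.mem_filter] at hφ
    rw [Finset.mem_coe, mem_typeClass]
    exact (mem_typedSupport.1 hφ.1).2.2.1
  · intro φ hφ φ' hφ' h
    rw [Finset.mem_coe, Finset.mem_filter] at hφ hφ'
    have hx : φ.1 = φ'.1 := by
      funext ρ
      apply hα
      funext k
      have h1 := htight _ ((mem_typedSupport.1 hφ.1).2.2.2 ρ) k
      have h2 := htight _ ((mem_typedSupport.1 hφ'.1).2.2.2 ρ) k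
      simp only at h1 h2
      have hy : φ.2.1 ρ = φ'.2.1 ρ := by rw [hφ.2, hφ'.2]
      have hz : φ.2.2 ρ = φ'.2.2 ρ := by simp only at h; rw [h]
      rw [hy, hz] at h1
      linarith
    simp only at h
    exact Prod.ext hx (Prod.ext (hφ.2.trans hφ'.2.symm) h)

/-- Fibres of the third projection embed into `I_μ` via the first word (`β` injective).
[cite: KleinbergSawinSpeyer2018, §4 (proof of Thm. 13)] -/
theorem card_fibre₃_le_card_typeClass₁ (S : Finset (I × J × L)) {r : ℕ}
    (α : I → Fin r → ℤ) (β : J → Fin r → ℤ) (γ : L → Fin r → ℤ) (hβ : Function.Injective β)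
    (htight : ∀ s ∈ S, ∀ ρ, α s.1 ρ + β s.2.1 ρ + γ s.2.2 ρ = 0)
    (N : ℕ) (μ : I → ℕ) (ν : J → ℕ) (π : L → ℕ) (z : Fin N → L) :
    ((typedSupport S N μ ν π).filter fun φ => φ.2.2 = z).card ≤ (typeClass N μ).card := by
  refine Finset.card_le_card_of_injOn (fun φ => φ.1) (fun φ hφ => ?_) ?_
  · rw [Finset.mem_coe, Finset.mem_filter] at hφ
    rw [Finset.mem_coe, mem_typeClass]
    exact (mem_typedSupport.1 hφ.1).1
  · intro φ hφ φ' hφ' h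
    rw [Finset.mem_coe, Finset.mem_filter] at hφ hφ'
    have hy : φ.2.1 = φ'.2.1 := by
      funext ρ
      apply hβ
      funext k
      have h1 := htight _ ((mem_typedSupport.1 hφ.1).2.2.2 ρ) k
      have h2 := htight _ ((mem_typedSupport.1 hφ'.1).2.2.2 ρ) k
      simp only at h1 h2
      have hx : φ.1 ρ = φ'.1 ρ := by simp only at h; rw [h]
      have hz : φ.2.2 ρ = φ'.2.2 ρ := by rw [hφ.2, hφ'.2]
      rw [hx, hz] at h1
      linarith
    simp only at h
    exact Prod.ext h (Prod.ext hy (hφ.2.trans hφ'.2.symm))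

/-- **BCS Thm. 15.41, proof, step (B), with the fibre bound.**  As
`exists_free_diagonal_typedSupport`: a `b`-tight support `S` (injective `α, β, γ` into `ℤ^r`,
`α i + β j + γ l = 0` on `S`, entries of `α, β` bounded by `b`) and a non-empty typed support
`Φ = (I_μ × J_ν × L_π) ∩ S^N` admit a free diagonal `Δ ⊆ Φ` with
`min {|I_μ|, |J_ν|, |L_π|} · f · rothNumberNat (3 f') ≤ 288 f'² |Δ|`, `f' = max (f, b)`, where now
the largest fibre `f` is also recorded to satisfy `f ≤ max {|I_μ|, |J_ν|, |L_π|}` (fibres embed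
into type classes, `card_fibre₁_le_card_typeClass₂` etc.; KSS 2018, §4: `|V|/|W| ≤ |W|`).
[cite: BurgisserClausenShokrollahi1997, Thm. 15.41 (proof, p. 381, (B))] -/
theorem exists_free_diagonal_typedSupport_fibre (S : Finset (I × J × L)) {r b : ℕ}
    (α : I → Fin r → ℤ) (β : J → Fin r → ℤ) (γ : L → Fin r → ℤ)
    (hα : Function.Injective α) (hβ : Function.Injective β) (hγ : Function.Injective γ)
    (hαb : ∀ i ρ, |α i ρ| ≤ b) (hβb : ∀ j ρ, |β j ρ| ≤ b)
    (htight : ∀ s ∈ S, ∀ ρ, α s.1 ρ + β s.2.1 ρ + γ s.2.2 ρ = 0)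
    (N : ℕ) (μ : I → ℕ) (ν : J → ℕ) (π : L → ℕ) (hne : (typedSupport S N μ ν π).Nonempty) :
    ∃ Δ : Finset ((Fin N → I) × (Fin N → J) × (Fin N → L)), Δ ⊆ typedSupport S N μ ν π ∧
      (∀ δ ∈ Δ, ∀ δ' ∈ Δ, ∀ δ'' ∈ Δ, (∀ ρ, (δ.1 ρ, δ'.2.1 ρ, δ''.2.2 ρ) ∈ S) →
        δ = δ' ∧ δ' = δ'') ∧
      ∃ f : ℕ, 1 ≤ f ∧
        f ≤ max (typeClass N μ).card (max (typeClass N ν).card (typeClass N π).card) ∧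
        min (typeClass N μ).card (min (typeClass N ν).card (typeClass N π).card) * f *
          rothNumberNat (3 * max f b) ≤ 288 * max f b ^ 2 * Δ.card := by
  classical
  obtain ⟨φ₀, hφ₀⟩ := hne
  obtain ⟨hμ₀, hν₀, hπ₀, -⟩ := mem_typedSupport.1 hφ₀
  -- the fibre bounds, before `Φ` is made opaque
  have hb₁ := card_fibre₁_le_card_typeClass₂ S α β γ hγ htight N μ ν π φ₀.1
  have hb₂ := card_fibre₂_le_card_typeClass₃ S α β γ hα htight N μ ν π φ₀.2.1
  have hb₃ := card_fibre₃_le_card_typeClass₁ S α β γ hβ htight N μ ν π φ₀.2.2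
  -- the typed support, made opaque
  obtain ⟨Φ, hΦ⟩ : ∃ Φ : Finset ((Fin N → I) × (Fin N → J) × (Fin N → L)),
      Φ = typedSupport S N μ ν π := ⟨_, rfl⟩
  rw [← hΦ] at hφ₀ hb₁ hb₂ hb₃ ⊢
  -- the tightness maps on words: concatenate the vectors of the letters
  let αN : (Fin N → I) → Fin (N * r) → ℤ := fun x t =>
    α (x (finProdFinEquiv.symm t).1) (finProdFinEquiv.symm t).2
  let βN : (Fin N → J) → Fin (N * r) → ℤ := fun y t =>
    β (y (finProdFinEquiv.symm t).1) (finProdFinEquiv.symm t).2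
  let γN : (Fin N → L) → Fin (N * r) → ℤ := fun z t =>
    γ (z (finProdFinEquiv.symm t).1) (finProdFinEquiv.symm t).2
  have hαN : Function.Injective αN := wordVec_injective α hα
  have hβN : Function.Injective βN := wordVec_injective β hβ
  have hγN : Function.Injective γN := wordVec_injective γ hγ
  have hαNb : ∀ x t, |αN x t| ≤ b := fun x t => hαb _ _
  have hβNb : ∀ y t, |βN y t| ≤ b := fun y t => hβb _ _
  have htightN : ∀ φ ∈ Φ, ∀ t, αN φ.1 t + βN φ.2.1 t + γN φ.2.2 t = 0 := by
    intro φ hφ t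
    rw [hΦ] at hφ
    exact htight _ ((mem_typedSupport.1 hφ).2.2.2 _) _
  -- the three fibre sizes and their maximum `f`
  set f₁ := (Φ.filter fun φ => φ.1 = φ₀.1).card with hf₁
  set f₂ := (Φ.filter fun φ => φ.2.1 = φ₀.2.1).card with hf₂
  set f₃ := (Φ.filter fun φ => φ.2.2 = φ₀.2.2).card with hf₃
  set f := max f₁ (max f₂ f₃) with hf
  have hf₁1 : 1 ≤ f₁ := Finset.card_pos.2 ⟨φ₀, Finset.mem_filter.2 ⟨hφ₀, rfl⟩⟩
  have hf1 : 1 ≤ f := le_trans hf₁1 (le_max_left _ _)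
  have hfmax : f ≤ max (typeClass N μ).card (max (typeClass N ν).card (typeClass N π).card) := by
    refine max_le (hb₁.trans ((le_max_left _ _).trans (le_max_right _ _))) (max_le ?_ ?_)
    · exact hb₂.trans ((le_max_right _ _).trans (le_max_right _ _))
    · exact hb₃.trans (le_max_left _ _)
  have hfI : ∀ x, (Φ.filter fun φ => φ.1 = x).card ≤ f := fun x =>
    (hΦ ▸ card_fibre₁_le S μ ν π hμ₀ x).trans (le_max_left _ _)
  have hfJ : ∀ y, (Φ.filter fun φ => φ.2.1 = y).card ≤ f := fun y =>
    (hΦ ▸ card_fibre₂_le S μ ν π hν₀ y).trans ((le_max_left _ _).trans (le_max_right _ _))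
  have hfL : ∀ z, (Φ.filter fun φ => φ.2.2 = z).card ≤ f := fun z =>
    (hΦ ▸ card_fibre₃_le S μ ν π hπ₀ z).trans ((le_max_right _ _).trans (le_max_right _ _))
  -- `|Φ| = |I_μ| f₁ = |J_ν| f₂ = |L_π| f₃ ≥ f · min`
  have hΦ₁ : Φ.card = (typeClass N μ).card * f₁ := by
    rw [hf₁, hΦ]; exact card_typedSupport_eq_mul_fibre₁ S μ ν π hμ₀
  have hΦ₂ : Φ.card = (typeClass N ν).card * f₂ := by
    rw [hf₂, hΦ]; exact card_typedSupport_eq_mul_fibre₂ S μ ν π hν₀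
  have hΦ₃ : Φ.card = (typeClass N π).card * f₃ := by
    rw [hf₃, hΦ]; exact card_typedSupport_eq_mul_fibre₃ S μ ν π hπ₀
  have hΦmin : min (typeClass N μ).card (min (typeClass N ν).card (typeClass N π).card) * f ≤
      Φ.card := by
    have hcases : f = f₁ ∨ f = f₂ ∨ f = f₃ := by omega
    rcases hcases with h | h | h
    · rw [h, hΦ₁]
      exact Nat.mul_le_mul_right _ (min_le_left _ _)
    · rw [h, hΦ₂]
      exact Nat.mul_le_mul_right _ ((min_le_right _ _).trans (min_le_left _ _))
    · rw [h, hΦ₃]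
      exact Nat.mul_le_mul_right _ ((min_le_right _ _).trans (min_le_right _ _))
  -- a Bertrand prime `6 f' < M ≤ 12 f'`, `f' = max f b`
  set f' := max f b with hf'
  have hff' : f ≤ f' := le_max_left _ _
  have hbf' : b ≤ f' := le_max_right _ _
  have hf'1 : 1 ≤ f' := le_trans hf1 hff'
  obtain ⟨M, hMp, hM1, hM2⟩ := Nat.exists_prime_lt_and_le_two_mul (6 * f') (by omega)
  haveI : NeZero M := ⟨hMp.ne_zero⟩
  have hbM : 2 * b < M := by omega
  have hM3 : 2 * (M / 2) ≤ M := Nat.mul_div_le M 2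
  have hfM : 3 * f' ≤ M / 2 := by omega
  have hM12 : M ≤ 12 * f' := by omega
  -- the Salem–Spencer diagonal with `k = M / 2` and the hashing theorem
  obtain ⟨D₁, D₂, D₃, hD₁, hD₂, hD₃, hDcard⟩ := exists_zeroSum_diagonal M (M / 2) hM3
  obtain ⟨Δ, hΔΦ, hfree, hsize⟩ := BCS1997_thm1539_free Φ αN βN γN hαN hβN hγN hαNb hβNb htightN
    hfI hfJ hfL hMp hbM D₁ D₂ D₃ hD₁ hD₂ hD₃
  refine ⟨Δ, hΔΦ, ?_, f, hf1, hfmax, ?_⟩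
  · -- freeness with respect to the coordinatewise support
    intro δ hδ δ' hδ' δ'' hδ'' hS
    have h1 := hΔΦ hδ; have h2 := hΔΦ hδ'; have h3 := hΔΦ hδ''
    rw [hΦ, mem_typedSupport] at h1 h2 h3
    refine hfree δ hδ δ' hδ' δ'' hδ'' ?_
    rw [hΦ, mem_typedSupport]
    exact ⟨h1.1, h2.2.1, h3.2.2.1, hS⟩
  · -- the size bound, from `|Φ| |D| (M - 3f) ≤ M³ |Δ|` with `6f' < M ≤ 12 f'`
    obtain ⟨D, hD⟩ : ∃ D : Finset (ZMod M × ZMod M × ZMod M),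
        D = (D₁ ×ˢ D₂ ×ˢ D₃).filter fun d => d.1 + d.2.1 + d.2.2 = 0 := ⟨_, rfl⟩
    rw [← hD] at hsize hDcard
    have hroth : rothNumberNat (3 * f') ≤ D.card := (rothNumberNat.mono hfM).trans hDcard
    have hM0 : (0 : ℤ) < M := by exact_mod_cast hMp.pos
    have hΦD : (0 : ℤ) ≤ (Φ.card : ℤ) * D.card := mul_nonneg (Nat.cast_nonneg _) (Nat.cast_nonneg _)
    have hM6 : (6 * f : ℤ) < M := by exact_mod_cast (show 6 * f < M by omega)
    have h1 : (Φ.card : ℤ) * D.card * M ≤ 2 * (M : ℤ) ^ 3 * Δ.card :=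
      calc (Φ.card : ℤ) * D.card * M ≤ (Φ.card : ℤ) * D.card * (2 * ((M : ℤ) - 3 * f)) :=
            mul_le_mul_of_nonneg_left (by linarith only [hM6]) hΦD
        _ = 2 * ((Φ.card : ℤ) * D.card * ((M : ℤ) - 3 * f)) := by ring
        _ ≤ 2 * ((M : ℤ) ^ 3 * Δ.card) := mul_le_mul_of_nonneg_left hsize (by norm_num)
        _ = 2 * (M : ℤ) ^ 3 * Δ.card := by ring
    have h2 : (Φ.card : ℤ) * D.card ≤ 2 * (M : ℤ) ^ 2 * Δ.card := by
      refine le_of_mul_le_mul_right ?_ hM0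
      calc (Φ.card : ℤ) * D.card * M ≤ 2 * (M : ℤ) ^ 3 * Δ.card := h1
        _ = 2 * (M : ℤ) ^ 2 * Δ.card * M := by ring
    have hMsq : (M : ℤ) ^ 2 ≤ (12 * f' : ℤ) ^ 2 :=
      pow_le_pow_left₀ hM0.le (by exact_mod_cast hM12) 2
    have h3 : (Φ.card : ℤ) * rothNumberNat (3 * f') ≤ 288 * (f' : ℤ) ^ 2 * Δ.card :=
      calc (Φ.card : ℤ) * rothNumberNat (3 * f') ≤ (Φ.card : ℤ) * D.card :=
            mul_le_mul_of_nonneg_left (by exact_mod_cast hroth) (Nat.cast_nonneg _)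
        _ ≤ 2 * (M : ℤ) ^ 2 * Δ.card := h2
        _ ≤ 2 * (12 * (f' : ℤ)) ^ 2 * Δ.card :=
            mul_le_mul_of_nonneg_right (mul_le_mul_of_nonneg_left hMsq (by norm_num))
              (Nat.cast_nonneg _)
        _ = 288 * (f' : ℤ) ^ 2 * Δ.card := by ring
    have h4 : ((min (typeClass N μ).card (min (typeClass N ν).card (typeClass N π).card) * f :
        ℕ) : ℤ) * rothNumberNat (3 * f') ≤ 288 * (f' : ℤ) ^ 2 * Δ.card :=
      le_trans (mul_le_mul_of_nonneg_right (by exact_mod_cast hΦmin) (Nat.cast_nonneg _)) h3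
    exact_mod_cast h4

end Literature.Computability.AlgebraicComplexity
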